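import Literature.MathematicalPhysics.KineticTheory.PureQuarticChainSemigroup
import Literature.MathematicalPhysics.KineticTheory.LangevinChainConfinedH2Shell
import Literature.MathematicalPhysics.KineticTheory.PureQuarticScaleDissipation
import Literature.MathematicalPhysics.KineticTheory.LangevinChainH2Proof
import HarnessLib

/-!
# CEHR Theorem 5.1 / Remark 5.2 (H2) for the purely quartic chain, and the discharge `CuneoEckmannHairerReyBellet2018_pureQuarticChain_holds`

Topic `Literature/MathematicalPhysics/KineticTheory`. Final proof file of the provefact unit for the
named fact `CuneoEckmannHairerReyBellet2018_pureQuarticChain` (`PureQuarticChainNESS.lean`):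
Cuneo–Eckmann–Hairer–Rey-Bellet, *Non-equilibrium steady states for networks of oscillators*, EJP
**23** (2018) no. 55, Theorem 2.13 (weak-stationarity corollary) for the purely quartic chain
`pureQuarticChain μ γ = ⟨μq⁴/4, r⁴/4, γ⟩` (`μ, γ > 0`, `N ≥ 1`, `T_L, T_R > 0`).

`PureQuarticChainSemigroup.lean` reduced the fact to the Lyapunov condition **H2** (CEHR Thm 5.1 /
Rem 5.2 at `t* = 1`) for the constructed transition kernels `langevinKernel` of the SDE (2.2)
(model-free pipeline of `LangevinChainConfined.lean`). This file PROVES H2 for the purely quartic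
chain, assembling the tree's Itô-free route exactly as `LangevinChainH2Proof.lean` does for the
pinned chain — at energy `E = K⁴`, over the window `1/K`:

* `pureQuarticChain_langevinSolMap_isIntegralSolutionOn` — the pathwise solution
  `Φ_t(z, B) = langevinSolMap … t z (pairPath ω)` solves `z(t) = x + (0, η(t)) + ∫₀ᵗ Y(z)` with the
  momentum noise `η = (n(t)).2`, `n = pairNoise v_L v_R (pairPath ω)`; on
  `goodEvent (√K/c) (1/K)` the noise has size `≤ √K` (`norm_noise_le_of_mem_goodEvent`);
* `pureQuarticChain_window_decay_of_dissipation` — one window: the dissipation `≥ εK³`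
  (`PureQuarticScaleDissipation.lean`, CEHR Prop. 5.3) beats the energy error `O(√K K²)` of a noise
  path of size `√K` (`PureQuarticPathwiseEnergy.lean`), the bad event `{sup|B| > √K/c}` is `O(1/K)`
  (`BrownianSupTail.lean`, `wienerPair_compl_goodEvent_le`) and is absorbed by Hölder and (3.4)
  (`LangevinChainConfinedH2Shell.lean`): `P_{1/K} e^{θH}(z) ≤ κ₀ e^{θH(z)}`;
* `pureQuarticChain_H2` — **CEHR Thm 5.1 / Rem 5.2 for the purely quartic chain, PROVED**: for every
  `0 < θ < 1/max(T_L,T_R)` there are `κ ∈ [0,1)`, `c ≥ 0` with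
  `∫ e^{θH} dP_1(z,·) ≤ κ e^{θH(z)} + c` for all `z` (Chapman–Kolmogorov and (3.4) on the remaining
  time, `decay_of_window`, `H2_of_decay`; the weaker decay of Carmona 2007 / Remark 5.7 in place of (5.1));
* `CuneoEckmannHairerReyBellet2018_pureQuarticChain_holds` — **the discharge**.

Everything is PROVED; no definition, no named fact.

## References

* N. Cuneo, J.-P. Eckmann, M. Hairer, L. Rey-Bellet, EJP **23** (2018) no. 55 (arXiv:1712.09413):
  Thm 2.13, §3 eqs. (3.4)–(3.6), Prop. 3.7, Thm 5.1, Rem 5.2, Prop. 5.3, §5.1, Rem 5.7.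
* P. Carmona, Stoch. Proc. Appl. **117** (2007) 1076–1092.
-/

noncomputable section

open MeasureTheory ProbabilityTheory Filter Topology Set Metric
open scoped NNReal ENNReal

namespace Literature.MathematicalPhysics.KineticTheory.HeatConduction

open Literature.Probability.Process Literature.Analysis.ODE OscillatorChain
  Literature.MathematicalPhysics.KineticTheory

variable {N : ℕ}

/-! ### The pathwise solution map solves the integral equation with the momentum noise -/

section SolMap

variable {P : OscillatorChain} {T_L T_R : ℝ}

/-- The noise path of the Brownian pair takes momentum values: `n(t) = (0, n(t).2)`. [folklore] -/
theorem OscillatorChain.IsConfining.pairNoise_eq_mk (hP : P.IsConfining) (N : ℕ) (T_L T_R : ℝ) (w : WienerPair) (t : ℝ) :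
    pairNoise (P.bathVecL N T_L) (P.bathVecR N T_R) w t =
      ((0 : Fin N → ℝ), (pairNoise (P.bathVecL N T_L) (P.bathVecR N T_R) w t).2) := by
  have hmem : pairNoise (P.bathVecL N T_L) (P.bathVecR N T_R) w t ∈ momentumSubspace N :=
    pairNoise_mem _ _ (hP.bathVec_mem_noise N _ _) (hP.bathVec_mem_noise N _ _) w t
  rw [mem_momentumSubspace] at hmem
  ext i
  · simp [hmem]
  · rfl

/-- **The pathwise solution map solves the integral equation of the driven chain**: for a chain
with confining potentials, `t ↦ Φ_t(x, w) = langevinSolMap … t x w` is a continuous solution of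
`z(t) = x + (0, η(t)) + ∫₀ᵗ Y(z(s)) ds` on every `[0, T]`, with the momentum noise
`η(t) = (n(t)).2`, `n = pairNoise v_L v_R w`. [cite: CuneoEckmannHairerReyBellet2018, eq. (2.2)] -/
theorem OscillatorChain.IsConfining.langevinSolMap_isIntegralSolutionOn (hP : P.IsConfining) (N : ℕ) (T_L T_R : ℝ)
    (x : PhaseSpace N) (w : WienerPair) (T : ℝ) :
    IsIntegralSolutionOn (P.drift N)
      (fun t => x + ((0 : Fin N → ℝ), (pairNoise (P.bathVecL N T_L) (P.bathVecR N T_R) w t).2))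
      (fun t => P.langevinSolMap N T_L T_R t x w) T := by
  have h := (hP.confinedDrift N).toConfinedDrift.isIntegralSolutionOn_flow x
    (continuous_pairNoise (P.bathVecL N T_L) (P.bathVecR N T_R) w)
    (pairNoise_mem _ _ (hP.bathVec_mem_noise N _ _) (hP.bathVec_mem_noise N _ _) w) T
  intro t ht
  have h1 := h t ht
  beta_reduce at h1
  beta_reduce
  rw [hP.pairNoise_eq_mk N T_L T_R w t] at h1
  exact h1

/-- The momentum noise `t ↦ (n(t)).2` is continuous. [folklore] -/
theorem continuous_pairNoise_snd (P : OscillatorChain) (N : ℕ) (T_L T_R : ℝ) (w : WienerPair) :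
    Continuous fun t => (pairNoise (P.bathVecL N T_L) (P.bathVecR N T_R) w t).2 :=
  continuous_snd.comp (continuous_pairNoise _ _ w)

/-- **On the good event the momentum noise is small**: `‖(n(s)).2‖ ≤ (|√(2γT_L)| + |√(2γT_R)|) a`
for `s ≤ h`, `n = pairNoise v_L v_R (pairPath ξ)`, `ξ ∈ goodEvent a h`. [folklore] -/
theorem norm_pairNoise_snd_le_of_mem_goodEvent (P : OscillatorChain) (N : ℕ) (T_L T_R : ℝ)
    {a : ℝ} {h : ℝ≥0} {ξ : WienerPair} (hξ : ξ ∈ goodEvent a h) {s : ℝ} (hs : s ≤ h) :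
    ‖(pairNoise (P.bathVecL N T_L) (P.bathVecR N T_R) (pairPath ξ) s).2‖ ≤
      (|Real.sqrt (2 * P.γ * T_L)| + |Real.sqrt (2 * P.γ * T_R)|) * a := by
  have h1 := norm_pairNoise_pairPath_le (P.bathVecL N T_L) (P.bathVecR N T_R) ξ s
  have h2 := abs_brownian_toNNReal_le_of_mem_goodEvent hξ hs
  have hvL : ‖P.bathVecL N T_L‖ ≤ |Real.sqrt (2 * P.γ * T_L)| := norm_bathVec_le N 0 _
  have hvR : ‖P.bathVecR N T_R‖ ≤ |Real.sqrt (2 * P.γ * T_R)| := norm_bathVec_le N (N - 1) _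
  have ha0 : 0 ≤ a := (abs_nonneg _).trans h2.1
  calc ‖(pairNoise (P.bathVecL N T_L) (P.bathVecR N T_R) (pairPath ξ) s).2‖
      ≤ ‖pairNoise (P.bathVecL N T_L) (P.bathVecR N T_R) (pairPath ξ) s‖ := norm_snd_le _
    _ ≤ |brownian s.toNNReal ξ.1| * ‖P.bathVecL N T_L‖ + |brownian s.toNNReal ξ.2| * ‖P.bathVecR N T_R‖ := h1
    _ ≤ a * |Real.sqrt (2 * P.γ * T_L)| + a * |Real.sqrt (2 * P.γ * T_R)| :=
        add_le_add (mul_le_mul h2.1 hvL (norm_nonneg _) ha0) (mul_le_mul h2.2 hvR (norm_nonneg _) ha0)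
    _ = (|Real.sqrt (2 * P.γ * T_L)| + |Real.sqrt (2 * P.γ * T_R)|) * a := by ring

end SolMap

/-! ### One window: from the dissipation bound to the decay of `P_{1/K} e^{θH}` -/

section Window

variable {μ γ : ℝ} {T_L T_R : ℝ}
variable (hμ : 0 < μ) (hγ : 0 < γ) (hN : 0 < N) (hTL : 0 < T_L) (hTR : 0 < T_R)
include hμ hγ hN hTL hTR

set_option maxHeartbeats 1600000 in
/-- **The decay over the window `1/K` from a pathwise dissipation bound** (purely quartic chain).
At scale `K` (`H(z) ≤ 2K⁴`, `K ≥ max(1, C)`), if every noise path of size `≤ √K` makes the smooth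
part of every solution of the driven equation dissipate at least `Dis` over `[0, 1/K]`, the energy
error `(9C + 9N/2)√K K²` of `PureQuarticPathwiseEnergy.lean` is at most `Dis/2`,
`θ Dis/2 ≥ log(2/κ₀)`, and `K` is so large that the bad event `{sup |B| > √K/c}` is negligible,
then `P_{1/K} e^{θH}(z) ≤ κ₀ e^{θH(z)}` for the constructed kernels `langevinKernel`.
[cite: CuneoEckmannHairerReyBellet2018, Thm 5.1 (proof, p. 12)] -/
theorem pureQuarticChain_window_decay_of_dissipation {θ : ℝ} (hθ : 0 < θ) {p : ℝ} (hp : 1 < p)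
    (hpθ : p * θ < 1 / max T_L T_R) {K Dis κ₀ : ℝ} (hK : 1 ≤ K)
    (hKC : pureQuarticEnergyConst μ γ N ≤ K) (hκ₀ : 0 < κ₀) {z : PhaseSpace N}
    (hz2 : (pureQuarticChain μ γ).hamiltonian N z ≤ 2 * K ^ 4)
    (hdis : ∀ η : ℝ → Fin N → ℝ, Continuous η → (∀ s ∈ Icc 0 (1 / K), ‖η s‖ ≤ Real.sqrt K) →
      ∀ zp : ℝ → PhaseSpace N, Continuous zp →
        IsIntegralSolutionOn ((pureQuarticChain μ γ).drift N)
          (fun s => z + ((0 : Fin N → ℝ), η s)) zp (1 / K) →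
        Dis ≤ γ * ∫ s in (0 : ℝ)..1 / K, ∑ i, bathWeight N i * (zp s - ((0 : Fin N → ℝ), η s)).2 i ^ 2)
    (herr : (9 * pureQuarticEnergyConst μ γ N + 9 * N / 2) * Real.sqrt K * K ^ 2 ≤ Dis / 2)
    (hD : Real.log (2 / κ₀) ≤ θ * Dis / 2)
    (hcs : 4 * (|Real.sqrt (2 * γ * T_L)| + |Real.sqrt (2 * γ * T_R)| + 1) ^ 2 ≤ K)
    (hbad : 16 * (|Real.sqrt (2 * γ * T_L)| + |Real.sqrt (2 * γ * T_R)| + 1) ^ 4 / K ≤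
      (κ₀ / (2 * Real.exp (θ * γ * (T_L + T_R) * 1))) ^ (1 - p⁻¹)⁻¹) :
    ∃ w : ℝ≥0, w ≤ 1 ∧
      ∫⁻ y, ENNReal.ofReal (Real.exp (θ * (pureQuarticChain μ γ).hamiltonian N y))
          ∂((pureQuarticChain μ γ).langevinKernel N T_L T_R w z) ≤
        ENNReal.ofReal (κ₀ * Real.exp (θ * (pureQuarticChain μ γ).hamiltonian N z)) := by
  set P := pureQuarticChain μ γ with hP
  set H := P.hamiltonian N with hH
  set C := pureQuarticEnergyConst μ γ N with hC
  have hPc : P.IsConfining := pureQuarticChain_isConfining hμ hγ.le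
  set c_L := Real.sqrt (2 * γ * T_L) with hcL
  set c_R := Real.sqrt (2 * γ * T_R) with hcR
  set cs := |c_L| + |c_R| + 1 with hcs'
  have hcs1 : 1 ≤ cs := by rw [hcs']; linarith [abs_nonneg c_L, abs_nonneg c_R]
  have hcs0 : 0 < cs := by linarith
  have hK0 : 0 < K := by linarith
  have hC0 : 0 ≤ C := pureQuarticEnergyConst_nonneg hμ γ N
  set M := Real.sqrt K with hM
  have hM1 : 1 ≤ M := by rw [hM, Real.le_sqrt (by norm_num) hK0.le]; simpa using hK
  have hM0 : 0 < M := by linarith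
  have hMK : M * M = K := Real.mul_self_sqrt hK0.le
  have hMleK : M ≤ K := by nlinarith
  set w : ℝ≥0 := ⟨1 / K, by positivity⟩ with hw
  have hwc : ((w : ℝ≥0) : ℝ) = 1 / K := rfl
  have hw1 : 1 / K ≤ 1 := by rw [div_le_one hK0]; exact hK
  set a := M / cs with ha
  set Cst := θ * γ * (T_L + T_R) with hCst
  have hCst0 : 0 ≤ Cst := by rw [hCst]; have := hTL.le; have := hTR.le; positivity
  set G := Real.exp (Cst * 1) with hG
  set D := θ * Dis / 2 with hDdef
  refine ⟨w, by exact_mod_cast hw1, ?_⟩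
  -- the pathwise energy drop on the good event
  have hgood : ∀ ξ ∈ goodEvent a w,
      θ * H (P.langevinSolMap N T_L T_R w z (pairPath ξ)) ≤ θ * H z - D := by
    intro ξ hξ'
    set η : ℝ → Fin N → ℝ := fun t => (pairNoise (P.bathVecL N T_L) (P.bathVecR N T_R) (pairPath ξ) t).2
      with hη
    have hηc : Continuous η := continuous_pairNoise_snd P N T_L T_R (pairPath ξ)
    set zp : ℝ → PhaseSpace N := fun t => P.langevinSolMap N T_L T_R t z (pairPath ξ) with hzp
    have hzpc : Continuous zp := hPc.continuous_langevinSolMap N T_L T_R z (pairPath ξ)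
    have hzpIE : IsIntegralSolutionOn (P.drift N) (fun t => z + ((0 : Fin N → ℝ), η t)) zp (1 / K) :=
      hPc.langevinSolMap_isIntegralSolutionOn N T_L T_R z (pairPath ξ) (1 / K)
    have hMb : ∀ s ∈ Icc 0 (1 / K), ‖η s‖ ≤ M := by
      intro s hs
      have h1 := norm_pairNoise_snd_le_of_mem_goodEvent P N T_L T_R hξ' (s := s) (by rw [hwc]; exact hs.2)
      have hγ' : P.γ = γ := rfl
      rw [hγ'] at h1
      refine h1.trans ?_
      rw [ha, ← hcL, ← hcR, mul_div_assoc', div_le_iff₀ hcs0]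
      nlinarith [abs_nonneg c_L, abs_nonneg c_R, hM0.le]
    have hMT : C * M * (1 / K) ≤ K := by
      calc C * M * (1 / K) ≤ K * K * (1 / K) := by
            refine mul_le_mul_of_nonneg_right (mul_le_mul hKC hMleK hM0.le hK0.le) (by positivity)
        _ = K := by field_simp
    have hdrop := pureQuarticChain_hamiltonian_le_sub_dissipation hμ hγ.le N hK hz2 hηc hzpc
      (T := 1 / K) (M := M) hMb hMT hzpIE (t := 1 / K) ⟨by positivity, le_rfl⟩
    have hdiss := hdis η hηc hMb zp hzpc hzpIE
    have hsol : P.langevinSolMap N T_L T_R w z (pairPath ξ) = zp (1 / K) := rfl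
    rw [hsol]
    -- the energy error is `≤ (9C + 9N/2) √K K² ≤ Dis/2`
    have hK2 : K ≤ M * K ^ 2 := by nlinarith [hM1, hK0]
    have herr' : 9 * C * (1 / K) * M * K ^ 3 + N * M * (4 * K ^ 2 + M / 2) ≤ Dis / 2 := by
      have e1 : 9 * C * (1 / K) * M * K ^ 3 = 9 * C * M * K ^ 2 := by field_simp
      have e2 : N * M * (4 * K ^ 2 + M / 2) = 4 * N * M * K ^ 2 + N * K / 2 := by
        rw [mul_add, show (N : ℝ) * M * (M / 2) = N * (M * M) / 2 by ring, hMK]; ring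
      rw [e1, e2]
      have h3 : N * K / 2 ≤ N / 2 * M * K ^ 2 := by
        have := mul_le_mul_of_nonneg_left hK2 (by positivity : (0 : ℝ) ≤ N / 2)
        linarith
      have h4 : 9 * C * M * K ^ 2 + 4 * N * M * K ^ 2 + N / 2 * M * K ^ 2 = (9 * C + 9 * N / 2) * M * K ^ 2 := by
        ring
      linarith [herr]
    have : H (zp (1 / K)) ≤ H z - Dis / 2 := by
      have hdrop' : H (zp (1 / K)) ≤ H z - γ * (∫ s in (0 : ℝ)..1 / K, ∑ i, bathWeight N i *
          (zp s - ((0 : Fin N → ℝ), η s)).2 i ^ 2) + 9 * C * (1 / K) * M * K ^ 3 +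
          N * M * (4 * K ^ 2 + M / 2) := hdrop
      linarith
    rw [hDdef]
    nlinarith [hθ]
  -- the probabilistic shell
  have hP3 := hPc.window_decay_of_pathwise (pureQuarticChain_contDiff_U μ γ) (pureQuarticChain_contDiff_V μ γ)
    hN hTL hTR hθ hp hpθ w a D z hgood
  refine hP3.trans ?_
  -- the three factors
  have hr0 : 0 < 1 - p⁻¹ := by
    have : p⁻¹ < 1 := inv_lt_one_of_one_lt₀ hp
    linarith
  have h1 : Real.exp (-D) ≤ κ₀ / 2 := by
    have hD' : Real.log (2 / κ₀) ≤ D := by rw [hDdef]; linarith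
    have := Real.exp_le_exp.2 (neg_le_neg hD')
    rw [Real.exp_neg (Real.log (2 / κ₀)), Real.exp_log (by positivity), inv_div] at this
    exact this
  have hγ' : P.γ = γ := rfl
  have h2 : Real.exp (θ * P.γ * (T_L + T_R) * w) ≤ G := by
    rw [hG, hCst, hγ']; refine Real.exp_le_exp.2 ?_
    rw [hwc]
    exact mul_le_mul_of_nonneg_left hw1 hCst0
  set y₀ := κ₀ / (2 * G) with hy₀
  have hy₀0 : 0 < y₀ := by positivity
  have hGpos : 0 < G := by rw [hG]; exact Real.exp_pos _
  have hGy : G * y₀ = κ₀ / 2 := by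
    rw [hy₀]; field_simp
  have h3 : (wienerPair (goodEvent a w)ᶜ) ^ (1 - p⁻¹) ≤ ENNReal.ofReal y₀ := by
    have hb := wienerPair_compl_goodEvent_le hK hcs1 w (by rw [hwc]; exact hw1)
      (by rw [hwc]; nlinarith [sq_nonneg cs, hw1])
    have hb' : (wienerPair (goodEvent a w)ᶜ) ^ (1 - p⁻¹) ≤ (ENNReal.ofReal (16 * cs ^ 4 / K)) ^ (1 - p⁻¹) :=
      ENNReal.rpow_le_rpow hb hr0.le
    refine hb'.trans ?_
    rw [ENNReal.ofReal_rpow_of_nonneg (by positivity) hr0.le]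
    refine ENNReal.ofReal_le_ofReal ?_
    have hx : 16 * cs ^ 4 / K ≤ y₀ ^ (1 - p⁻¹)⁻¹ := by
      rw [hy₀, hG, hCst]; exact hbad
    calc (16 * cs ^ 4 / K) ^ (1 - p⁻¹) ≤ (y₀ ^ (1 - p⁻¹)⁻¹) ^ (1 - p⁻¹) :=
          Real.rpow_le_rpow (by positivity) hx hr0.le
      _ = y₀ := Real.rpow_inv_rpow hy₀0.le hr0.ne'
  calc ENNReal.ofReal (Real.exp (θ * H z)) * (ENNReal.ofReal (Real.exp (-D)) +
        ENNReal.ofReal (Real.exp (θ * P.γ * (T_L + T_R) * w)) * (wienerPair (goodEvent a w)ᶜ) ^ (1 - p⁻¹))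
      ≤ ENNReal.ofReal (Real.exp (θ * H z)) * (ENNReal.ofReal (κ₀ / 2) + ENNReal.ofReal G * ENNReal.ofReal y₀) := by
        have h1' := ENNReal.ofReal_le_ofReal h1
        have h2' := ENNReal.ofReal_le_ofReal h2
        gcongr
    _ = ENNReal.ofReal (κ₀ * Real.exp (θ * H z)) := by
        rw [← ENNReal.ofReal_mul hGpos.le, ← ENNReal.ofReal_add (by positivity) (by positivity),
          ← ENNReal.ofReal_mul (Real.exp_pos _).le, hGy]
        congr 1
        ring

end Window

/-! ### CEHR Theorem 5.1 / Remark 5.2 for the purely quartic chain -/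

set_option maxHeartbeats 3200000 in
/-- **Cuneo–Eckmann–Hairer–Rey-Bellet 2018, Theorem 5.1 with Remark 5.2 (the Lyapunov condition H2
for `V = e^{θH}` at `t* = 1`) for the transition kernels of the purely quartic chain, PROVED**
(`μ, γ > 0`, `N ≥ 1`, `T_L, T_R > 0`, `0 < θ < 1/max(T_L,T_R)`): there are `κ ∈ [0,1)` and `c ≥ 0`
with `∫ e^{θH} dP_1(z, ·) ≤ κ e^{θH(z)} + c` for all `z` (Remark 5.2: "there exist constants
`κ ∈ (0,1)` and `c > 0`, and a compact set `K` such that `E_z e^{θH(z_{t*})} ≤ κe^{θH(z)} + c1_K`";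
the compact set is absorbed in the constant). Conditions C1, C3–C5 hold for this chain (baths at
the ends; `U, V` homogeneous of degree `ℓ_p = ℓ_i = 4`, coercive; `n = 1`), so only the interaction
regime of §5.1 occurs: at energy `E = K⁴` the dissipation over the window `1/K`
(`pureQuarticChain_dissipation_ge`, Prop. 5.3) beats the energy error of a noise path of size `√K`,
the bad event is `O(1/K)`, whence the one-window decay
(`pureQuarticChain_window_decay_of_dissipation`), the decay at `t* = 1` by Chapman–Kolmogorov and
(3.4) (`decay_of_window`) and Remark 5.2's form (`H2_of_decay`).
[cite: CuneoEckmannHairerReyBellet2018, Thm 5.1 and Rem 5.2] -/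
theorem pureQuarticChain_H2 {μ γ : ℝ} (hμ : 0 < μ) (hγ : 0 < γ) (hN : 0 < N) {T_L T_R : ℝ}
    (hTL : 0 < T_L) (hTR : 0 < T_R) {θ : ℝ} (hθ : 0 < θ) (hθ' : θ < 1 / max T_L T_R) :
    ∃ κ c : ℝ, 0 ≤ κ ∧ κ < 1 ∧ 0 ≤ c ∧
      ∀ z : PhaseSpace N,
        ∫⁻ y, ENNReal.ofReal (Real.exp (θ * (pureQuarticChain μ γ).hamiltonian N y))
            ∂((pureQuarticChain μ γ).langevinKernel N T_L T_R 1 z) ≤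
          ENNReal.ofReal (κ * Real.exp (θ * (pureQuarticChain μ γ).hamiltonian N z) + c) := by
  have hPc : (pureQuarticChain μ γ).IsConfining := pureQuarticChain_isConfining hμ hγ.le
  -- the Hölder exponent `p` with `1 < p`, `pθ < 1/max(T_L,T_R)`
  have hTmax : 0 < max T_L T_R := lt_max_of_lt_left hTL
  have hθT0 : 0 < θ * max T_L T_R := mul_pos hθ hTmax
  have hθT : θ * max T_L T_R < 1 := by rwa [lt_div_iff₀ hTmax] at hθ'
  obtain ⟨p, hpdef⟩ : ∃ p : ℝ, p = (1 / (θ * max T_L T_R) + 1) / 2 := ⟨_, rfl⟩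
  have hp1 : 1 < p := by
    have h1 : 1 < 1 / (θ * max T_L T_R) := by rw [lt_div_iff₀ hθT0]; linarith only [hθT]
    rw [hpdef]; linarith only [h1]
  have hpθ : p * θ < 1 / max T_L T_R := by
    rw [hpdef, lt_div_iff₀ hTmax]
    have e : (1 / (θ * max T_L T_R) + 1) / 2 * θ * max T_L T_R = (1 + θ * max T_L T_R) / 2 := by
      field_simp
    rw [e]; linarith only [hθT]
  have hr0 : 0 < 1 - p⁻¹ := by have := inv_lt_one_of_one_lt₀ hp1; linarith only [this]
  -- the constants of the energy estimates
  set C := pureQuarticEnergyConst μ γ N with hC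
  have hC0 : 0 ≤ C := pureQuarticEnergyConst_nonneg hμ γ N
  obtain ⟨CI, hCI⟩ : ∃ CI : ℝ, CI = 9 * C + 9 * N / 2 := ⟨_, rfl⟩
  have hCI0 : 0 ≤ CI := by rw [hCI]; positivity
  obtain ⟨cs, hcs⟩ : ∃ cs : ℝ, cs = |Real.sqrt (2 * γ * T_L)| + |Real.sqrt (2 * γ * T_R)| + 1 := ⟨_, rfl⟩
  have hcs1 : 1 ≤ cs := by
    rw [hcs]; linarith only [abs_nonneg (Real.sqrt (2 * γ * T_L)), abs_nonneg (Real.sqrt (2 * γ * T_R))]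
  -- the decay factor `κ₀` and the thresholds it induces
  obtain ⟨G, hG⟩ : ∃ G : ℝ, G = Real.exp (θ * γ * (T_L + T_R) * 1) := ⟨_, rfl⟩
  have hG1 : 1 ≤ G := by
    rw [hG]; apply Real.one_le_exp
    have := hTL.le; have := hTR.le; positivity
  obtain ⟨κ₀, hκ₀⟩ : ∃ κ₀ : ℝ, κ₀ = 1 / (2 * G) := ⟨_, rfl⟩
  have hκ₀0 : 0 < κ₀ := by rw [hκ₀]; positivity
  have hκ₀1 : κ₀ ≤ 1 / 2 := by
    rw [hκ₀, div_le_div_iff₀ (by positivity) (by norm_num)]; linarith only [hG1]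
  have hκG : κ₀ * Real.exp (θ * (pureQuarticChain μ γ).γ * (T_L + T_R) * 1) ≤ 1 / 2 := by
    have hγ' : (pureQuarticChain μ γ).γ = γ := rfl
    rw [hγ', ← hG, hκ₀]
    have hG0 : G ≠ 0 := by linarith only [hG1]
    have e : 1 / (2 * G) * G = 1 / 2 := by field_simp
    rw [e]
  obtain ⟨L₀, hL₀⟩ : ∃ L₀ : ℝ, L₀ = Real.log (2 / κ₀) := ⟨_, rfl⟩
  have hL₀0 : 0 ≤ L₀ := by
    rw [hL₀]; apply Real.log_nonneg; rw [le_div_iff₀ hκ₀0]; linarith only [hκ₀1]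
  obtain ⟨y₀, hy₀⟩ : ∃ y₀ : ℝ, y₀ = κ₀ / (2 * G) := ⟨_, rfl⟩
  have hy₀0 : 0 < y₀ := by rw [hy₀]; positivity
  obtain ⟨x₀, hx₀⟩ : ∃ x₀ : ℝ, x₀ = y₀ ^ (1 - p⁻¹)⁻¹ := ⟨_, rfl⟩
  have hx₀0 : 0 < x₀ := by rw [hx₀]; exact Real.rpow_pos_of_pos hy₀0 _
  -- the dissipation package (interaction regime; the only one for quartic pinning)
  obtain ⟨KI, εI, hKI1, hεI, hI⟩ := pureQuarticChain_dissipation_ge (N := N) hμ hγ hN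
  -- the scale threshold `K₅` and the energy threshold `E₁ = K₅⁴`
  obtain ⟨K₅, hK₅⟩ : ∃ K₅ : ℝ, K₅ = 1 + KI + C + 4 * cs ^ 2 + (2 * CI / εI) ^ 2 + 16 * cs ^ 4 / x₀ +
      2 * L₀ / (θ * εI) := ⟨_, rfl⟩
  have hs1 : 0 ≤ KI := by linarith only [hKI1]
  have hs6 : 0 ≤ 4 * cs ^ 2 := by positivity
  have hs7 : 0 ≤ (2 * CI / εI) ^ 2 := by positivity
  have hs9 : 0 ≤ 16 * cs ^ 4 / x₀ := by positivity
  have hs10 : 0 ≤ 2 * L₀ / (θ * εI) := by positivity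
  obtain ⟨E₁, hE₁⟩ : ∃ E₁ : ℝ, E₁ = K₅ ^ 4 := ⟨_, rfl⟩
  refine hPc.H2_of_decay (pureQuarticChain_contDiff_U μ γ) (pureQuarticChain_contDiff_V μ γ) hN hTL hTR
    hθ hθ' 1 (E₁ := E₁)
    (hPc.decay_of_window (pureQuarticChain_contDiff_U μ γ) (pureQuarticChain_contDiff_V μ γ) hN hTL hTR
      hθ hθ' 1 (E₁ := E₁) (κ₀ := κ₀) hκG ?_)
  intro z hz
  -- the scale of `z`: `K = H(z)^{1/4} ≥ K₅`
  have hHz0 : 0 ≤ (pureQuarticChain μ γ).hamiltonian N z := pureQuarticChain_hamiltonian_nonneg hμ.le γ N z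
  obtain ⟨K, hKdef⟩ : ∃ K : ℝ, K = Real.sqrt (Real.sqrt ((pureQuarticChain μ γ).hamiltonian N z)) := ⟨_, rfl⟩
  have hK4 : K ^ 4 = (pureQuarticChain μ γ).hamiltonian N z := by
    rw [hKdef, show (4 : ℕ) = 2 * 2 from rfl, pow_mul, Real.sq_sqrt (Real.sqrt_nonneg _), Real.sq_sqrt hHz0]
  have hK₅1 : 1 ≤ K₅ := by rw [hK₅]; linarith only [hs1, hC0, hs6, hs7, hs9, hs10]
  have hK5 : K₅ ≤ K := by
    rw [hKdef, Real.le_sqrt (by linarith only [hK₅1]) (Real.sqrt_nonneg _), Real.le_sqrt (by positivity) hHz0]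
    calc (K₅ ^ 2) ^ 2 = E₁ := by rw [hE₁]; ring
      _ ≤ _ := hz
  have hthr : ∀ x : ℝ, x ≤ K₅ → x ≤ K := fun x hx => hx.trans hK5
  have hK1 : 1 ≤ K := hthr 1 (by rw [hK₅]; linarith only [hs1, hC0, hs6, hs7, hs9, hs10])
  have hK0 : 0 < K := by linarith only [hK1]
  have hKI : KI ≤ K := hthr _ (by rw [hK₅]; linarith only [hs1, hC0, hs6, hs7, hs9, hs10])
  have hKC : C ≤ K := hthr _ (by rw [hK₅]; linarith only [hs1, hC0, hs6, hs7, hs9, hs10])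
  have hKcs : 4 * cs ^ 2 ≤ K := hthr _ (by rw [hK₅]; linarith only [hs1, hC0, hs6, hs7, hs9, hs10])
  have hKeI : (2 * CI / εI) ^ 2 ≤ K := hthr _ (by rw [hK₅]; linarith only [hs1, hC0, hs6, hs7, hs9, hs10])
  have hKx : 16 * cs ^ 4 / x₀ ≤ K := hthr _ (by rw [hK₅]; linarith only [hs1, hC0, hs6, hs7, hs9, hs10])
  have hKLI : 2 * L₀ / (θ * εI) ≤ K := hthr _ (by rw [hK₅]; linarith only [hs1, hC0, hs6, hs7, hs9, hs10])
  have hz1 : K ^ 4 ≤ (pureQuarticChain μ γ).hamiltonian N z := hK4.le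
  have hz2 : (pureQuarticChain μ γ).hamiltonian N z ≤ 2 * K ^ 4 := by
    rw [← hK4]; linarith only [pow_nonneg hHz0 1, sq_nonneg (K ^ 2)]
  -- `M = √K`
  obtain ⟨M, hM⟩ : ∃ M : ℝ, M = Real.sqrt K := ⟨_, rfl⟩
  have hMK : M * M = K := by rw [hM]; exact Real.mul_self_sqrt hK0.le
  have hM1 : 1 ≤ M := by rw [hM, Real.le_sqrt (by norm_num) hK0.le]; simpa using hK1
  have hM0 : 0 < M := by linarith only [hM1]
  have hbadK : 16 * cs ^ 4 / K ≤ x₀ := by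
    rw [div_le_iff₀ hK0]
    have := hKx
    rw [div_le_iff₀ hx₀0] at this
    linarith only [this]
  have hKcs' : 4 * (|Real.sqrt (2 * γ * T_L)| + |Real.sqrt (2 * γ * T_R)| + 1) ^ 2 ≤ K := by
    rw [← hcs]; exact hKcs
  have hbadK' : 16 * (|Real.sqrt (2 * γ * T_L)| + |Real.sqrt (2 * γ * T_R)| + 1) ^ 4 / K ≤
      (κ₀ / (2 * Real.exp (θ * γ * (T_L + T_R) * 1))) ^ (1 - p⁻¹)⁻¹ := by
    rw [← hcs, ← hG, ← hy₀, ← hx₀]; exact hbadK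
  have hMeI : 2 * CI ≤ εI * M := by
    have h1 : 2 * CI / εI ≤ M := by rw [hM, Real.le_sqrt (by positivity) hK0.le]; exact hKeI
    rw [div_le_iff₀ hεI] at h1
    linarith only [h1]
  have hK2 : K ≤ K ^ 2 := by nlinarith only [hK1]
  have hK3 : K ^ 2 ≤ K ^ 3 := by nlinarith only [hK1, hK2]
  refine pureQuarticChain_window_decay_of_dissipation hμ hγ hN hTL hTR hθ hp1 hpθ (K := K)
    (Dis := εI * K ^ 3) (κ₀ := κ₀) hK1 hKC hκ₀0 hz2 ?_ ?_ ?_ hKcs' hbadK'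
  · intro η hη hηb zp hzpc hzp
    exact hI K hKI z hz1 hz2 η hη hηb zp hzpc hzp
  · -- the energy error `CI √K K² ≤ εI K³/2`
    rw [← hC, ← hM, ← hCI]
    have h6 : CI * M ≤ εI * (M * M) / 2 := by nlinarith only [hMeI, hM0]
    rw [hMK] at h6
    have h7 := mul_le_mul_of_nonneg_right h6 (sq_nonneg K)
    have e : εI * K / 2 * K ^ 2 = εI * K ^ 3 / 2 := by ring
    linarith only [h7, e]
  · -- `log(2/κ₀) ≤ θ εI K³/2`
    have h1 : 2 * L₀ ≤ θ * εI * K := by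
      have := hKLI
      rw [div_le_iff₀ (by positivity)] at this
      linarith only [this]
    have h2 : K ≤ K ^ 3 := hK2.trans hK3
    have h3 := mul_le_mul_of_nonneg_left h2 (by positivity : 0 ≤ θ * εI)
    rw [← hL₀]
    linarith only [h1, h3]

/-! ### The discharge -/

/-- **Cuneo–Eckmann–Hairer–Rey-Bellet 2018, Theorem 2.13 (weak-stationarity corollary for the
purely quartic chain), PROVED** — the named fact `CuneoEckmannHairerReyBellet2018_pureQuarticChain`
of `PureQuarticChainNESS.lean`: for `pureQuarticChain μ γ` (`U(q) = μq⁴/4`, `V(r) = r⁴/4`) with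
`μ, γ > 0`, every `N ≥ 1` and all `T_L, T_R > 0` there is a probability measure on phase space which
is a steady state in the weak Fokker–Planck sense (`OscillatorChain.IsSteadyState`), is absolutely
continuous with respect to Lebesgue measure, and integrates `e^{ϑH}` for every
`0 < ϑ < 1/max(T_L, T_R)`: H2 (`pureQuarticChain_H2`, CEHR Thm 5.1 / Rem 5.2) fed into
`CuneoEckmannHairerReyBellet2018_pureQuarticChain_of_H2` (Krylov–Bogoliubov for the family
`(e^{ϑH})_ϑ`, Prop. 3.7; Dynkin; Hörmander with the bracket condition for the degenerate coupling,
Props. 3.2 and 4.1). Unconditional. [cite: CuneoEckmannHairerReyBellet2018, Thm 2.13] -/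
theorem CuneoEckmannHairerReyBellet2018_pureQuarticChain_holds :
    CuneoEckmannHairerReyBellet2018_pureQuarticChain :=
  CuneoEckmannHairerReyBellet2018_pureQuarticChain_of_H2
    fun _ _ hμ hγ _ _ _ hN hL hR _ hθ hθ' => pureQuarticChain_H2 hμ hγ hN hL hR hθ hθ'

end Literature.MathematicalPhysics.KineticTheory.HeatConduction
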